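import Summits.ResolutionOfSingularities.ResolutionOfSingularities.Theorems.EquisingularLiftEquisingularLiftNatTangentConeFibreReduced
import Summits.ResolutionOfSingularities.ResolutionOfSingularities.Theorems.EquisingularLiftEquisingularLiftNatCarrierDeltaStalks
import Literature.AlgebraicGeometry.Resolution.SNCStrataSmooth
import HarnessLib

/-!
# [OURS · L1 W4.5(b) · EL♮] T-PTPRIME-DICT (2a/2): stalks of the reduced exceptional trace at presented points, and the algebra
# of one chart (a quotient of a localisation of `B_j` is a localisation of `k[T]/(ḡ_j)`)

Crux `EquisingularLiftNat` = stmt-ResolutionOfSingularities-20038 (route EquisingularLift), registered stub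
`stub_elnat_tcDeltaPointResolution` (any `n`); helper file `--supports stmt-ResolutionOfSingularities-20038 --as helper`. Object
T-PTPRIME-DICT (res-L1-w45b-lead-2 2026-08-27T09:31:41Z; res-type-100 09:30:25Z (B)); this file carries the two local ingredients of
`finite_badPrimes_of_finite_nonregular_carrierTrace` (file …NatExceptionalTracePrimes). HONEST FRAMING: OURS (cell res-hironaka,
slot W4.5(b)); NOT a statement of any manuscript. AI-written, weaker than expert review. No `sorry`; standard axioms.

SETTING (= res-type-097's `stalkIdeal_vanishingIdeal_carrierTrace_of_presentation`, file …NatTangentConeFibreReduced, with the base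
point a variable `x`): `υ : F' → F` any morphism with `F'` locally Noetherian, `R = 𝒪_{F,x}`, `c` a quasi-regular system of
generators of `𝔪_x`, `W ⊆ F` closed with `𝓘(W)_x = (Φ(c))`, `Φ` a form with reduction `φ ≠ 0`, `G ∈ R[T]` with reduction `ḡ`
such that (R1) `φ ∈ √(ḡ)`, `ḡ ∈ √(φ)` and (R2) `(ḡ(T_j := 1))` radical for all `j`,
`Z := vanishingIdeal (υ⁻¹{x} ∩ closure υ⁻¹(W ∖ {x}))` (the reduced exceptional trace), `B_j = R[𝔪_x/c_j]` the affine blowup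
algebras, `G_j := G(c/c_j) ∈ B_j`, `t_j := c_j/1 ∈ B_j`.

## Content (namespace `…Cruxes.EquisingularLiftNat.Sections`)

* `stalkIdeal_carrierTrace_of_presentation'` — 097's stalk formula `Z_{x'} = (χ G_j) + (χ t_j)` read at a point `x'` with
  `υ x' = x` (base point a variable; presentation in the `stalkCongr` currency of `exists_point_presentation_of_blowupAlgebra_prime`).
* `chi_mem_maximalIdeal_iff`, `mem_support_carrierTrace_of_presentation` — such an `x'` lies on `Z` as soon as `G_j, t_j ∈ 𝔔`.
* `exists_surjective_ker_eq_of_isLocalization_comap` — the pure algebra of one chart: for `Θ : B ↠ A` with kernel `(t)`, `O` a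
  localisation of `B` at `Θ⁻¹ 𝔮` and `Θ G = g ∈ 𝔮`, a surjection `O ↠ (A/(g))_{𝔮/(g)}` with kernel `(χ G) + (χ t)`
  (localisation commutes with quotients); `algebraMap_mem_maximalIdeal_sq_of_eq` — transport of `f ∈ 𝔪²` along an equality of primes.

References: Stacks 0804/0805/0BIQ through the cited tree files; p506193, p509910 (res-type-100), …NatTangentConeFibreReduced (res-type-097).
-/


set_option linter.dupNamespace false -- mandated namespace `Summit.<Summit>.<Problem>` of this single-conjunct summit

noncomputable section

open CategoryTheory AlgebraicGeometry TopologicalSpace Topology IsLocalRing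
open Literature.AlgebraicGeometry.Resolution
open AlgebraicGeometry.Scheme.IdealSheafData

namespace Summit.ResolutionOfSingularities.ResolutionOfSingularities.Cruxes.EquisingularLiftNat.Sections

universe u

section Trace

variable {F F' : Scheme.{u}} {υ : F' ⟶ F} {x : F}

/-- The canonical identification `𝒪_{F,υ x'} ≅ 𝒪_{F,υ x'}` (a loop at one point) is the identity. [folklore] -/
theorem stalkCongr_of_eq_refl_apply (x' : F') (a : F.presheaf.stalk (υ x')) :
    (F.presheaf.stalkCongr (.of_eq (rfl : υ x' = υ x').symm)).hom a = a := by
  rw [TopCat.Presheaf.stalkCongr_hom]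
  exact stalkSpecializes_self_apply F.presheaf (υ x') _ a

set_option maxHeartbeats 400000 in -- as in the cited stalk theorem (subalgebra-of-localisation unification)
/-- **The stalks of the reduced trace `Z` at a presented point over `x`** — res-type-097's
`stalkIdeal_vanishingIdeal_carrierTrace_of_presentation` with the base point a variable `x` and `υ x' = x`, the presentation
`(j, 𝔔, χ, e)` being compatible with `υ^♯_{x'}` through `𝒪_{F,x} ≅ 𝒪_{F,υ x'}`: `Z_{x'} = (χ G_j) + (χ t_j)`. [cite: StacksProject, Tag 0804] -/
theorem stalkIdeal_carrierTrace_of_presentation' [IsLocallyNoetherian F'] (hx : IsClosed ({x} : Set F))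
    (x' : F') (hx' : υ x' = x) {r : ℕ}
    (c : Fin r → F.presheaf.stalk x) (hc𝔪 : Ideal.span (Set.range c) = maximalIdeal (F.presheaf.stalk x))
    (hc : IsQuasiRegular c) (W : Closeds F) {d : ℕ} (Φ G : MvPolynomial (Fin r) (F.presheaf.stalk x))
    (hΦd : Φ.IsHomogeneous d) (hΦ : MvPolynomial.map (Ideal.Quotient.mk (Ideal.span (Set.range c))) Φ ≠ 0)
    (hW : stalkIdeal (Scheme.IdealSheafData.vanishingIdeal W) x = Ideal.span {MvPolynomial.eval c Φ})
    (hΦG : MvPolynomial.map (Ideal.Quotient.mk (Ideal.span (Set.range c))) Φ ∈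
      (Ideal.span {MvPolynomial.map (Ideal.Quotient.mk (Ideal.span (Set.range c))) G}).radical)
    (hGΦ : MvPolynomial.map (Ideal.Quotient.mk (Ideal.span (Set.range c))) G ∈
      (Ideal.span {MvPolynomial.map (Ideal.Quotient.mk (Ideal.span (Set.range c))) Φ}).radical)
    (hGrad : ∀ j, (Ideal.span {MvPolynomial.map (Ideal.Quotient.mk (Ideal.span (Set.range c)))
      (dehomogenize j G)}).IsRadical)
    (hZ : IsClosed (υ ⁻¹' {x} ∩ closure (υ ⁻¹' ((W : Set F) \ {x}))))
    (j : Fin r) (𝔔 : PrimeSpectrum (blowupAlgebra (Ideal.span (Set.range c)) (c j)))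
    (χ : blowupAlgebra (Ideal.span (Set.range c)) (c j) →+* F'.presheaf.stalk x')
    (e : F'.presheaf.stalk x' ≃+* Localization.AtPrime 𝔔.asIdeal)
    (hχ : ∀ a, χ (algebraMap _ _ a) = (υ.stalkMap x').hom ((F.presheaf.stalkCongr (.of_eq hx'.symm)).hom a))
    (he : ∀ b, e (χ b) = algebraMap _ (Localization.AtPrime 𝔔.asIdeal) b) :
    stalkIdeal (Scheme.IdealSheafData.vanishingIdeal
        ⟨υ ⁻¹' {x} ∩ closure (υ ⁻¹' ((W : Set F) \ {x})), hZ⟩) x' =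
      Ideal.span {χ (MvPolynomial.aeval (blowupAlgebra.frac c j) G)} ⊔
        Ideal.span {χ (algebraMap _ (blowupAlgebra (Ideal.span (Set.range c)) (c j)) (c j))} := by
  subst hx'
  have hχ' : ∀ a, χ (algebraMap _ _ a) = (υ.stalkMap x').hom a := fun a => by
    rw [hχ, stalkCongr_of_eq_refl_apply]
  exact stalkIdeal_vanishingIdeal_carrierTrace_of_presentation x' hx c hc𝔪 hc W Φ G hΦd hΦ hW hΦG hGΦ hGrad hZ
    j 𝔔 χ e hχ' he

/-- Along a presentation `e : 𝒪_{F',x'} ≅ (B_j)_𝔔` with `e ∘ χ = (· /1)`: `χ b ∈ 𝔪_{x'} ↔ b ∈ 𝔔`. [folklore] -/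
theorem chi_mem_maximalIdeal_iff {B : Type u} [CommRing B] {x' : F'} (𝔔 : PrimeSpectrum B)
    (χ : B →+* F'.presheaf.stalk x') (e : F'.presheaf.stalk x' ≃+* Localization.AtPrime 𝔔.asIdeal)
    (he : ∀ b, e (χ b) = algebraMap B (Localization.AtPrime 𝔔.asIdeal) b) (b : B) :
    χ b ∈ maximalIdeal (F'.presheaf.stalk x') ↔ b ∈ 𝔔.asIdeal := by
  rw [← IsLocalization.AtPrime.to_map_mem_maximal_iff (Localization.AtPrime 𝔔.asIdeal) 𝔔.asIdeal b, ← he,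
    IsLocalRing.mem_maximalIdeal, IsLocalRing.mem_maximalIdeal, mem_nonunits_iff, mem_nonunits_iff]
  exact (not_congr (MulEquiv.isUnit_map e)).symm

set_option maxHeartbeats 400000 in -- as above
/-- **A presented point with `G_j, t_j ∈ 𝔔` lies on the trace `Z`** (its stalk ideal is proper). [folklore] -/
theorem mem_support_carrierTrace_of_presentation [IsLocallyNoetherian F'] (hx : IsClosed ({x} : Set F))
    (x' : F') (hx' : υ x' = x) {r : ℕ}
    (c : Fin r → F.presheaf.stalk x) (hc𝔪 : Ideal.span (Set.range c) = maximalIdeal (F.presheaf.stalk x))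
    (hc : IsQuasiRegular c) (W : Closeds F) {d : ℕ} (Φ G : MvPolynomial (Fin r) (F.presheaf.stalk x))
    (hΦd : Φ.IsHomogeneous d) (hΦ : MvPolynomial.map (Ideal.Quotient.mk (Ideal.span (Set.range c))) Φ ≠ 0)
    (hW : stalkIdeal (Scheme.IdealSheafData.vanishingIdeal W) x = Ideal.span {MvPolynomial.eval c Φ})
    (hΦG : MvPolynomial.map (Ideal.Quotient.mk (Ideal.span (Set.range c))) Φ ∈
      (Ideal.span {MvPolynomial.map (Ideal.Quotient.mk (Ideal.span (Set.range c))) G}).radical)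
    (hGΦ : MvPolynomial.map (Ideal.Quotient.mk (Ideal.span (Set.range c))) G ∈
      (Ideal.span {MvPolynomial.map (Ideal.Quotient.mk (Ideal.span (Set.range c))) Φ}).radical)
    (hGrad : ∀ j, (Ideal.span {MvPolynomial.map (Ideal.Quotient.mk (Ideal.span (Set.range c)))
      (dehomogenize j G)}).IsRadical)
    (hZ : IsClosed (υ ⁻¹' {x} ∩ closure (υ ⁻¹' ((W : Set F) \ {x}))))
    (j : Fin r) (𝔔 : PrimeSpectrum (blowupAlgebra (Ideal.span (Set.range c)) (c j)))
    (χ : blowupAlgebra (Ideal.span (Set.range c)) (c j) →+* F'.presheaf.stalk x')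
    (e : F'.presheaf.stalk x' ≃+* Localization.AtPrime 𝔔.asIdeal)
    (hχ : ∀ a, χ (algebraMap _ _ a) = (υ.stalkMap x').hom ((F.presheaf.stalkCongr (.of_eq hx'.symm)).hom a))
    (he : ∀ b, e (χ b) = algebraMap _ (Localization.AtPrime 𝔔.asIdeal) b)
    (hG𝔔 : MvPolynomial.aeval (blowupAlgebra.frac c j) G ∈ 𝔔.asIdeal)
    (ht𝔔 : algebraMap _ (blowupAlgebra (Ideal.span (Set.range c)) (c j)) (c j) ∈ 𝔔.asIdeal) :
    x' ∈ (Scheme.IdealSheafData.vanishingIdeal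
        (⟨υ ⁻¹' {x} ∩ closure (υ ⁻¹' ((W : Set F) \ {x})), hZ⟩ : Closeds F')).support := by
  rw [mem_support_iff_stalkIdeal_le,
    stalkIdeal_carrierTrace_of_presentation' hx x' hx' c hc𝔪 hc W Φ G hΦd hΦ hW hΦG hGΦ hGrad hZ j 𝔔 χ e hχ he,
    sup_le_iff, Ideal.span_singleton_le_iff_mem, Ideal.span_singleton_le_iff_mem,
    chi_mem_maximalIdeal_iff 𝔔 χ e he, chi_mem_maximalIdeal_iff 𝔔 χ e he]
  exact ⟨hG𝔔, ht𝔔⟩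

end Trace

/-! ## The algebra of one chart: a quotient of a localisation of `B_j` is a localisation of `k[T]/(ḡ_j)` -/

section Algebra

/-- **Quotient of a localisation, read through a surjection.** Let `Θ : B ↠ A` be surjective with kernel `(t)`, `𝔮` a prime of
`A`, `χ : B → O` a localisation of `B` at `Θ⁻¹ 𝔮`, and `G ∈ B` with `Θ G = g ∈ 𝔮`. Then `O/((χ G) + (χ t)) ≅ (A/(g))_{𝔮/(g)}`:
there is a surjection `Λ : O ↠ (A/(g))_{𝔮/(g)}` with kernel `(χ G) + (χ t)` (localisation commutes with quotients). [folklore] -/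
theorem exists_surjective_ker_eq_of_isLocalization_comap {A B O : Type*} [CommRing A] [CommRing B] [CommRing O]
    (Θ : B →+* A) (hΘsurj : Function.Surjective Θ) (t G : B) (g : A) (hΘG : Θ G = g)
    (hkerΘ : ∀ y, Θ y = 0 ↔ y ∈ Ideal.span {t}) (𝔮 : Ideal A) [𝔮.IsPrime] (hg : g ∈ 𝔮)
    [(𝔮.map (Ideal.Quotient.mk (Ideal.span {g}))).IsPrime]
    (χ : B →+* O) (hloc : @IsLocalization.AtPrime _ _ O _ χ.toAlgebra (𝔮.comap Θ) (Ideal.comap_isPrime Θ 𝔮)) :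
    ∃ Λ : O →+* Localization.AtPrime (𝔮.map (Ideal.Quotient.mk (Ideal.span {g}))),
      Function.Surjective Λ ∧ RingHom.ker Λ = Ideal.span {χ G} ⊔ Ideal.span {χ t} := by
  classical
  letI algBO : Algebra B O := χ.toAlgebra
  haveI : IsLocalization.AtPrime O (𝔮.comap Θ) := hloc
  have hχalg : ∀ b, algebraMap B O b = χ b := fun _ => rfl
  have hker𝔮 : RingHom.ker (Ideal.Quotient.mk (Ideal.span {g})) ≤ 𝔮 := by
    rw [Ideal.mk_ker, Ideal.span_singleton_le_iff_mem]; exact hg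
  have hQ'c : (𝔮.map (Ideal.Quotient.mk (Ideal.span {g}))).comap (Ideal.Quotient.mk (Ideal.span {g})) = 𝔮 := by
    rw [Ideal.comap_map_of_surjective _ Ideal.Quotient.mk_surjective, ← RingHom.ker_eq_comap_bot, sup_eq_left]
    exact hker𝔮
  have hmemQ' : ∀ a : A, Ideal.Quotient.mk (Ideal.span {g}) a ∈ 𝔮.map (Ideal.Quotient.mk (Ideal.span {g})) ↔ a ∈ 𝔮 :=
    fun a => by rw [← Ideal.mem_comap, hQ'c]
  have hΘt : Θ t = 0 := (hkerΘ t).mpr (Ideal.mem_span_singleton_self t)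
  -- `ρ : B → L'`, `b ↦ (Θ b mod g)/1`, inverts `B ∖ Θ⁻¹ 𝔮`; `Λ : O → L'` the induced map
  let L' := Localization.AtPrime (𝔮.map (Ideal.Quotient.mk (Ideal.span {g})))
  let ρ : B →+* L' := (algebraMap (A ⧸ Ideal.span {g}) L').comp ((Ideal.Quotient.mk (Ideal.span {g})).comp Θ)
  have hρ : ∀ b, ρ b = algebraMap (A ⧸ Ideal.span {g}) L' (Ideal.Quotient.mk (Ideal.span {g}) (Θ b)) := fun b => rfl
  have hρu : ∀ u : (𝔮.comap Θ).primeCompl, IsUnit (ρ u) := by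
    intro u
    rw [hρ]
    apply IsLocalization.map_units L' (⟨_, ?_⟩ : (𝔮.map (Ideal.Quotient.mk (Ideal.span {g}))).primeCompl)
    rw [Ideal.mem_primeCompl_iff, hmemQ']
    exact fun h => Ideal.mem_primeCompl_iff.mp u.2 (Ideal.mem_comap.mpr h)
  let Λ : O →+* L' := IsLocalization.lift (M := (𝔮.comap Θ).primeCompl) (S := O) hρu
  have hΛχ : ∀ b, Λ (χ b) = ρ b := fun b => by
    rw [← hχalg]; exact IsLocalization.lift_eq (M := (𝔮.comap Θ).primeCompl) (S := O) hρu b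
  have hunit : ∀ v, v ∉ 𝔮.comap Θ → IsUnit (χ v) := fun v hv =>
    IsLocalization.map_units O (⟨v, hv⟩ : (𝔮.comap Θ).primeCompl)
  refine ⟨Λ, ?_, ?_⟩
  · -- `Λ` is surjective: `a'/s' = Λ (χ b · (χ v)⁻¹)` for lifts `Θ b ↦ a'`, `Θ v ↦ s'`
    intro τ
    obtain ⟨⟨a', s'⟩, hts⟩ := IsLocalization.surj (𝔮.map (Ideal.Quotient.mk (Ideal.span {g}))).primeCompl τ
    have hts' : τ * algebraMap _ L' (s' : A ⧸ Ideal.span {g}) = algebraMap _ L' a' := hts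
    obtain ⟨a, ha⟩ := Ideal.Quotient.mk_surjective a'
    obtain ⟨s, hs⟩ := Ideal.Quotient.mk_surjective (s' : A ⧸ Ideal.span {g})
    obtain ⟨b, rfl⟩ := hΘsurj a
    obtain ⟨v, rfl⟩ := hΘsurj s
    have hv : v ∉ 𝔮.comap Θ := by
      intro hv
      have : (s' : A ⧸ Ideal.span {g}) ∈ 𝔮.map (Ideal.Quotient.mk (Ideal.span {g})) := by
        rw [← hs, hmemQ']; exact hv
      exact s'.2 this
    have hvu : IsUnit (χ v) := hunit v hv
    refine ⟨χ b * ↑(hvu.unit⁻¹), ?_⟩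
    have h1 : Λ (χ v) * Λ ↑(hvu.unit⁻¹) = 1 := by
      rw [← map_mul, IsUnit.mul_val_inv, map_one]
    have hρv : Λ (χ v) = algebraMap _ L' (s' : A ⧸ Ideal.span {g}) := by rw [hΛχ, hρ, hs]
    have hρb : Λ (χ b) = algebraMap _ L' a' := by rw [hΛχ, hρ, ha]
    rw [map_mul, hρb]
    calc algebraMap _ L' a' * Λ ↑(hvu.unit⁻¹)
        = τ * (algebraMap _ L' (s' : A ⧸ Ideal.span {g}) * Λ ↑(hvu.unit⁻¹)) := by rw [← hts']; ring
      _ = τ := by rw [← hρv, h1, mul_one]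
  · -- `ker Λ = (χ G) + (χ t)`
    apply le_antisymm
    · intro w hw
      rw [RingHom.mem_ker] at hw
      obtain ⟨⟨b, u⟩, hbu⟩ := IsLocalization.surj (𝔮.comap Θ).primeCompl w
      have hbu' : w * χ (u : B) = χ b := hbu
      -- `ρ b = 0`
      have hb0 : ρ b = 0 := by
        rw [← hΛχ, ← hbu', map_mul, hw, zero_mul]
      rw [hρ, IsLocalization.map_eq_zero_iff (𝔮.map (Ideal.Quotient.mk (Ideal.span {g}))).primeCompl] at hb0
      obtain ⟨⟨s', hs'⟩, hsb⟩ := hb0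
      obtain ⟨s, rfl⟩ := Ideal.Quotient.mk_surjective s'
      obtain ⟨v, rfl⟩ := hΘsurj s
      have hv : v ∉ 𝔮.comap Θ := fun hv => (Ideal.mem_primeCompl_iff.mp hs') ((hmemQ' _).mpr hv)
      -- `Θ (v b) ∈ (g) = (Θ G)`, so `v b ∈ (G) + (t)`
      have hvb : Ideal.Quotient.mk (Ideal.span {g}) (Θ (v * b)) = 0 := by
        rw [map_mul, map_mul]; exact hsb
      rw [Ideal.Quotient.eq_zero_iff_mem, Ideal.mem_span_singleton'] at hvb
      obtain ⟨a, ha⟩ := hvb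
      obtain ⟨w', rfl⟩ := hΘsurj a
      have hmem : v * b - w' * G ∈ Ideal.span {t} := by
        rw [← hkerΘ, map_sub, sub_eq_zero, map_mul Θ w' G, hΘG, ha]
      have hvbK : v * b ∈ Ideal.span {G} ⊔ Ideal.span {t} := by
        have : v * b = w' * G + (v * b - w' * G) := by ring
        rw [this]
        exact Ideal.add_mem _ (Ideal.mem_sup_left (Ideal.mul_mem_left _ _ (Ideal.mem_span_singleton_self _)))
          (Ideal.mem_sup_right hmem)
      -- push to `O`: `χ v · χ b ∈ (χ G) + (χ t)`, `χ v` a unit, and `w · χ u = χ b`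
      have hχvb : χ v * χ b ∈ Ideal.span {χ G} ⊔ Ideal.span {χ t} := by
        rw [← map_mul]
        have himg := Ideal.mem_map_of_mem χ hvbK
        rw [Ideal.map_sup, Ideal.map_span, Ideal.map_span, Set.image_singleton, Set.image_singleton] at himg
        exact himg
      have hvu : IsUnit (χ v) := hunit v hv
      have huu : IsUnit (χ (u : B)) := hunit u (Ideal.mem_primeCompl_iff.mp u.2)
      have hχb : χ b ∈ Ideal.span {χ G} ⊔ Ideal.span {χ t} := by
        have := Ideal.mul_mem_left _ (↑(hvu.unit⁻¹) : O) hχvb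
        rwa [← mul_assoc, IsUnit.val_inv_mul, one_mul] at this
      have hwb : w = χ b * ↑(huu.unit⁻¹) := by
        rw [← hbu', mul_assoc, IsUnit.mul_val_inv, mul_one]
      rw [hwb]
      exact Ideal.mul_mem_right _ _ hχb
    · rw [sup_le_iff, Ideal.span_singleton_le_iff_mem, Ideal.span_singleton_le_iff_mem, RingHom.mem_ker, RingHom.mem_ker,
        hΛχ, hΛχ, hρ, hρ, hΘG, hΘt, map_zero, map_zero, Ideal.Quotient.eq_zero_iff_mem.mpr (Ideal.mem_span_singleton_self _),
        map_zero]
      exact ⟨rfl, rfl⟩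

/-- Transport of the `𝔪²`-membership condition along an equality of primes (the localisation types differ). [folklore] -/
theorem algebraMap_mem_maximalIdeal_sq_of_eq {A : Type*} [CommRing A] (f : A) (P P' : Ideal A) [P.IsPrime] [P'.IsPrime]
    (h : P = P') (hf : algebraMap A (Localization.AtPrime P') f ∈ maximalIdeal (Localization.AtPrime P') ^ 2) :
    algebraMap A (Localization.AtPrime P) f ∈ maximalIdeal (Localization.AtPrime P) ^ 2 := by
  subst h
  exact hf

end Algebra

end Summit.ResolutionOfSingularities.ResolutionOfSingularities.Cruxes.EquisingularLiftNat.Sections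

end
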